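/-
Origin: expansion seat `planner-pub-hodgecm-mc-axioms-1-g14-0`, handover #W227 2026-08-20T15:53:55Z md5 dd28975732fd (PKG aa0453a1b7df → dd28975732fd; 193 l.; MECHANICAL (iib-R) rewrite v3.1 of the PKG file as it stands (114 token edits; rules R1x1+RX[h₂]x113)) (`HOME/mc/pub-hodgecm-mc-axioms-1-g14/revendor/kit-r55/stage55/HodgeCM/Model/Binders/Real34OfJunctions.lean`, md5 dd28975732fd, 193 lines);
landed by the gen-22 packager (p-g22) in gate run 55 REPLACES the earlier landed copy of `HodgeCM/Model/Binders/Real34OfJunctions.lean` (seat copy carried the packager Origin header of an earlier run (stripped)).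
-/
/-
Origin: speedrun cell pub-hodgecm, MODEL-CONSTRUCTION sub-cell, unit pub-hodgecm-mc-binder-1-g7 (BINDER PROVER, gen 7; node
B2-meet, BINDER-OWNERS row 15 `real34`), seat prover-pub-hodgecm-mc-binder-1-g7-0, 2026-08-19.
(W1) REVISION ⁗′ (RUN 37): tokens as #14 ⁗; (E3) `hlev` DISCHARGED (`hlev_holds`) AND (J-cov′) `hcov` DISCHARGED (`hcov_holds` := glue-1-g6 #349 `Junction/EmbLevelCover.embOf_pullC_cover_cup2C_eq_pieceLift` through the rfl bridge) — `Real34Junctions.funBridge J hpc hcup hph` and `real34_of_loc hpc hcup hph J` take neither. + `import HodgeCM.Model.Junction.EmbLevelCover`.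
Target in PKG: HodgeCM/Model/Binders/Real34OfJunctions.lean (NEW additive leaf; imports this kit's row #14 `Model/Binders/Real34Meet` only
(‴ world); nothing landed imports it).  KERNEL ONLY: 0 records, nothing cited, 0 `def … : Prop`, MODEL-N ±0.
r3 (binder-1-g8, 2026-08-19, APPEND-ONLY over r2 c4ad8cad0035: r2's `real34FunBridgeOfJunctions` / `real34_of_junctions` kept byte-identical for
their importer `Model/Binders/Real34GenMem` (mc-discharge-1 D-6); ADDED § (r3): record `Real34Junctions extends Real34Loc` + {(K34) `gen_mem` at
`Real34Loc.wset`, `hι`, `hU₂`, `hU₃`}, `Real34Junctions.funBridge`, and **`real34_of_loc`** = E's `real34` VERBATIM over the r3 route (imports #14 r3).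
-/
import Summits.HodgeConjecture.HodgeCM.Model.Binders.Real34Meet
import Summits.HodgeConjecture.HodgeCM.Model.Junction.EmbLevelCover

/-!
# E's binder `real34` from the (34) junctions

Row 15 of `HOME/BINDER-OWNERS.md`: E's binder

  `real34 : ∀ V c, GoodCtx → [c.K : ℚ] = 6 → Nonempty ((thetaModelOf …).Real34FunBridge V c)`.

`Real34FunBridge = {wset, gen_mem, meet}` (PKG `Model/Binders/MeetBridges`).  With `wset := wset34` (row #14: realised global wedges of
saturated representatives of theta one-forms of types 2, 3) the field `meet` is `meet_of_pieceUnfolding` (row #14) and the ONE field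
with mathematical content not typed in this kit is

  (K34) `gen_mem : ∀ χ Φ, ϑ₃₄(χ, Φ) ∈ closure (span wset34)` — PerL v5 Lemma 3.5 (34) in FUNCTION form: the (34) theta lifts of
  `𝒮^κ` are limits of combinations of global wedge-functions of (34) theta one-forms (density of `K`-finite vectors + `K_{ι₁}`-types +
  (eq:seesaw) on pure tensors — the see-saw half is row #8 `Real34Seesaw.t34_ϑc_mk_eq_smul_integral_mul_integral`; the `K`-type half
  is the `QautCore` shell, binder-2 lineage).

**`real34_of_junctions`** — E's `real34` VERBATIM from (K34), (L-loc) (row #14's localisation hypothesis — the meeting-lemma lane's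
export), `hι`, `Fact_pull_comp` and C3 for types 2, 3, each as a family over the good contexts; the regime `hV` is derived
(`isAnisotropic_of_goodCtx`).  Nothing here is a claim of the manuscripts under adjudication.
-/

set_option autoImplicit false

noncomputable section

open scoped InnerProductSpace Matrix
open MeasureTheory MulAction Literature.MeasureTheory.Group
open Literature.NumberTheory.Automorphic Literature.NumberTheory.Automorphic.UnitaryGroup
open Literature.NumberTheory.Automorphic.LevelOrbit
open Literature.Geometry.ComplexHyperbolic.BallModel (U21 Ball x₀ Jac)
open Literature.AlgebraicGeometry.ShimuraVarieties
open NumberField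

namespace HodgeCM

namespace Model

open Literature.AlgebraicGeometry.HodgeTheory
open Literature.NumberTheory.Automorphic.PicardCM
open Literature.NumberTheory.Transcendental (Arapura2012_Cor_15_4_6)

variable (hHD : exists_isReal_hodgeModel) (hI : hodgePQ_independent_of_hodgeModel)
  (h₁ : BallQuotientUniformised)  (h₃ : CMAbelianVarietyRealised)
variable (h : Bool) (hA : Arapura2012_Cor_15_4_6)
  (W : ∀ {L : CMField} {ι₁ : L →+* ℂ} (V : HermSpace3 L ι₁) (c : SeesawCtx L), WmInput V c.D)
  (S : ∀ {L : CMField} {ι₁ : L →+* ℂ} (V : HermSpace3 L ι₁) (c : SeesawCtx L), ThetaAdelicSide V c)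
  (μ : ∀ {L : CMField}, SeesawCtx L → Fin 4 → InfinitePlace L → ℤ)

/-- **The (34) function bridge at `(V, c)` in the regime** from (K34) `gen_mem`, (L-loc) `hloc` and the inputs of `meet_of_localisation`. -/
def real34FunBridgeOfJunctions {L : CMField} {ι₁ : L →+* ℂ} (V : HermSpace3 L ι₁) (c : SeesawCtx L) (hV : IsAnisotropic L V.Hm)
    (gen_mem : ∀ (χ : ((pinT hHD hI h₁ h₃ h hA W S μ).t34 V c).X) (Φ : (pinT hHD hI h₁ h₃ h hA W S μ).SK V c),
      ((pinT hHD hI h₁ h₃ h hA W S μ).t34 V c).ϑ χ Φ ∈ (Submodule.span ℂ (wset34 hHD hI h₁ h₃ h hA W S μ V c hV)).topologicalClosure)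
    (hι : ∀ u : U21, (S V c).ιinf u =
      Adelic.regimeEquiv L V.Hm hV (archSectionU21CM (L : Type) ι₁ V.Hm V.sylvesterFrame (sylvesterFrame_J V) u))
    (hpc : (picardCMUniverse hHD hI h₁ h₃).Fact_pull_comp)
    (hloc : (∀ (Γ₁ : Level V) (ω₁ ω₂ : (picardCMUniverse hHD hI h₁ h₃).CohC ((picardCMUniverse hHD hI h₁ h₃).pms L ι₁ V Γ₁) 1),
      ω₁ ∈ (picardCMUniverse hHD hI h₁ h₃).Uiso Γ₁ c.K (c.Ψ 0) c.σ → ω₂ ∈ (picardCMUniverse hHD hI h₁ h₃).Uiso Γ₁ c.K (c.Ψ 1) c.σ →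
      ∀ P ∈ wset34 hHD hI h₁ h₃ h hA W S μ V c hV, ⟪(pinT hHD hI h₁ h₃ h hA W S μ).Λ Γ₁ ω₁ ω₂, P⟫_ℂ ≠ 0 →
      ∃ (Γ : Level V) (hle : Γ.Γ ≤ Γ₁.Γ) (cl₃ cl₄ : ((pinX hHD hI h₁ h₃ S V c hV).D Γ).H10) (G₃ G₄ : (quotU V).leftInvCont₂),
        (cl₃ : (picardCMUniverse hHD hI h₁ h₃).CohC ((picardCMUniverse hHD hI h₁ h₃).pms L ι₁ V Γ) 1) ∈ (pinT hHD hI h₁ h₃ h hA W S μ).Theta V c 2 Γ ∧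
        (cl₄ : (picardCMUniverse hHD hI h₁ h₃).CohC ((picardCMUniverse hHD hI h₁ h₃).pms L ι₁ V Γ) 1) ∈ (pinT hHD hI h₁ h₃ h hA W S μ).Theta V c 3 Γ ∧
        SatLevel V hV Γ G₃ ∧ SatLevel V hV Γ G₄ ∧
        ((((pinX hHD hI h₁ h₃ S V c hV).D Γ).pull cl₃).1 : (pinX hHD hI h₁ h₃ S V c hV).G₁ → (Fin 2 → ℂ)) = (G₃ : (quotU V).G → (Fin 2 → ℂ)) ∘ ((pinX hHD hI h₁ h₃ S V c hV).ιinf Γ) ∧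
        ((((pinX hHD hI h₁ h₃ S V c hV).D Γ).pull cl₄).1 : (pinX hHD hI h₁ h₃ S V c hV).G₁ → (Fin 2 → ℂ)) = (G₄ : (quotU V).G → (Fin 2 → ℂ)) ∘ ((pinX hHD hI h₁ h₃ S V c hV).ιinf Γ) ∧
        ⟪(pinT hHD hI h₁ h₃ h hA W S μ).Λ Γ ((picardCMUniverse hHD hI h₁ h₃).pullC ((pinT hHD hI h₁ h₃ h hA W S μ).cover Γ₁ Γ hle) 1 ω₁) ((picardCMUniverse hHD hI h₁ h₃).pullC ((pinT hHD hI h₁ h₃ h hA W S μ).cover Γ₁ Γ hle) 1 ω₂),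
          (quotU V).realise ((quotU V).wedge₂ G₃ G₄)⟫_ℂ ≠ 0))
    (hU₂ : ∀ Γ : Level V, (pinT hHD hI h₁ h₃ h hA W S μ).Theta V c 2 Γ ⊆ (picardCMUniverse hHD hI h₁ h₃).Uiso Γ c.K (c.Ψ 2) c.σ)
    (hU₃ : ∀ Γ : Level V, (pinT hHD hI h₁ h₃ h hA W S μ).Theta V c 3 Γ ⊆ (picardCMUniverse hHD hI h₁ h₃).Uiso Γ c.K (c.Ψ 3) c.σ) :
    (pinT hHD hI h₁ h₃ h hA W S μ).Real34FunBridge V c where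
  wset := wset34 hHD hI h₁ h₃ h hA W S μ V c hV
  gen_mem := gen_mem
  meet := meet_of_localisation hHD hI h₁ h₃ h hA W S μ V c hV hι hpc hloc hU₂ hU₃

/-- **E's binder `real34` IN ITS QUANTIFIED FORM** from (K34), (L-loc) and the (34) junction hypotheses at every good sextic context
(regime `hV := isAnisotropic_of_goodCtx`). -/
theorem real34_of_junctions (hpc : (picardCMUniverse hHD hI h₁ h₃).Fact_pull_comp)
    (J : ∀ {L : CMField} {ι₁ : L →+* ℂ} (V : HermSpace3 L ι₁) (c : SeesawCtx L) (hV : IsAnisotropic L V.Hm),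
      (pinT hHD hI h₁ h₃ h hA W S μ).GoodCtx ι₁ c → Module.finrank ℚ c.K = 6 →
      (∀ (χ : ((pinT hHD hI h₁ h₃ h hA W S μ).t34 V c).X) (Φ : (pinT hHD hI h₁ h₃ h hA W S μ).SK V c),
        ((pinT hHD hI h₁ h₃ h hA W S μ).t34 V c).ϑ χ Φ ∈ (Submodule.span ℂ (wset34 hHD hI h₁ h₃ h hA W S μ V c hV)).topologicalClosure) ∧
      (∀ u : U21, (S V c).ιinf u =
        Adelic.regimeEquiv L V.Hm hV (archSectionU21CM (L : Type) ι₁ V.Hm V.sylvesterFrame (sylvesterFrame_J V) u)) ∧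
      (∀ (Γ₁ : Level V) (ω₁ ω₂ : (picardCMUniverse hHD hI h₁ h₃).CohC ((picardCMUniverse hHD hI h₁ h₃).pms L ι₁ V Γ₁) 1),
      ω₁ ∈ (picardCMUniverse hHD hI h₁ h₃).Uiso Γ₁ c.K (c.Ψ 0) c.σ → ω₂ ∈ (picardCMUniverse hHD hI h₁ h₃).Uiso Γ₁ c.K (c.Ψ 1) c.σ →
      ∀ P ∈ wset34 hHD hI h₁ h₃ h hA W S μ V c hV, ⟪(pinT hHD hI h₁ h₃ h hA W S μ).Λ Γ₁ ω₁ ω₂, P⟫_ℂ ≠ 0 →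
      ∃ (Γ : Level V) (hle : Γ.Γ ≤ Γ₁.Γ) (cl₃ cl₄ : ((pinX hHD hI h₁ h₃ S V c hV).D Γ).H10) (G₃ G₄ : (quotU V).leftInvCont₂),
        (cl₃ : (picardCMUniverse hHD hI h₁ h₃).CohC ((picardCMUniverse hHD hI h₁ h₃).pms L ι₁ V Γ) 1) ∈ (pinT hHD hI h₁ h₃ h hA W S μ).Theta V c 2 Γ ∧
        (cl₄ : (picardCMUniverse hHD hI h₁ h₃).CohC ((picardCMUniverse hHD hI h₁ h₃).pms L ι₁ V Γ) 1) ∈ (pinT hHD hI h₁ h₃ h hA W S μ).Theta V c 3 Γ ∧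
        SatLevel V hV Γ G₃ ∧ SatLevel V hV Γ G₄ ∧
        ((((pinX hHD hI h₁ h₃ S V c hV).D Γ).pull cl₃).1 : (pinX hHD hI h₁ h₃ S V c hV).G₁ → (Fin 2 → ℂ)) = (G₃ : (quotU V).G → (Fin 2 → ℂ)) ∘ ((pinX hHD hI h₁ h₃ S V c hV).ιinf Γ) ∧
        ((((pinX hHD hI h₁ h₃ S V c hV).D Γ).pull cl₄).1 : (pinX hHD hI h₁ h₃ S V c hV).G₁ → (Fin 2 → ℂ)) = (G₄ : (quotU V).G → (Fin 2 → ℂ)) ∘ ((pinX hHD hI h₁ h₃ S V c hV).ιinf Γ) ∧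
        ⟪(pinT hHD hI h₁ h₃ h hA W S μ).Λ Γ ((picardCMUniverse hHD hI h₁ h₃).pullC ((pinT hHD hI h₁ h₃ h hA W S μ).cover Γ₁ Γ hle) 1 ω₁) ((picardCMUniverse hHD hI h₁ h₃).pullC ((pinT hHD hI h₁ h₃ h hA W S μ).cover Γ₁ Γ hle) 1 ω₂),
          (quotU V).realise ((quotU V).wedge₂ G₃ G₄)⟫_ℂ ≠ 0) ∧
      (∀ Γ : Level V, (pinT hHD hI h₁ h₃ h hA W S μ).Theta V c 2 Γ ⊆ (picardCMUniverse hHD hI h₁ h₃).Uiso Γ c.K (c.Ψ 2) c.σ) ∧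
      (∀ Γ : Level V, (pinT hHD hI h₁ h₃ h hA W S μ).Theta V c 3 Γ ⊆ (picardCMUniverse hHD hI h₁ h₃).Uiso Γ c.K (c.Ψ 3) c.σ))
    {L : CMField} {ι₁ : L →+* ℂ} (V : HermSpace3 L ι₁) (c : SeesawCtx L)
    (hc : (pinT hHD hI h₁ h₃ h hA W S μ).GoodCtx ι₁ c) (hK : Module.finrank ℚ c.K = 6) :
    Nonempty ((pinT hHD hI h₁ h₃ h hA W S μ).Real34FunBridge V c) := by
  obtain ⟨gen_mem, hι, hloc, hU₂, hU₃⟩ := J V c (isAnisotropic_of_goodCtx V hc hK) hc hK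
  exact ⟨real34FunBridgeOfJunctions hHD hI h₁ h₃ h hA W S μ V c (isAnisotropic_of_goodCtx V hc hK) gen_mem hι hpc hloc hU₂ hU₃⟩

/-!
## r3: E's `real34` over the decomposed (L-loc) (binder-1-g8)

ROW-15 TYPE LEDGER (r3): `real34` ⟸ (K34) `gen_mem` ⊕ (J-sat) `sat` ⊕ (J-τ34)(c) `transl`/`descend` ⊕ (J-cov′) `hcov` ⊕ (E3) `hlev` ⊕ `hι` ⊕ C3₂,₃ ⊕
`Fact_pull_comp`/`Fact_pull_cup` — the meeting step is no longer a hypothesis (`real34_of_loc`).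
-/

variable {L : CMField} {ι₁ : L →+* ℂ} (V : HermSpace3 L ι₁) (c : SeesawCtx L) (hV : IsAnisotropic L V.Hm)

/-- **(J-cov′) DISCHARGED** (glue-1-g6 `Junction/EmbLevelCover.embOf_pullC_cover_cup2C_eq_pieceLift`, RUN-37 row #349, through the rfl
bridge `pieceEmb_eq_regimeTransportL2`): the restricted emb-lane junction `hcov` of `Real34Loc.meet` holds at the pin from the universe
facts `Fact_pull_cup` / `Fact_pull_hodge`. -/
theorem hcov_holds (hcup : (picardCMUniverse hHD hI h₁ h₃).Fact_pull_cup) (hph : (picardCMUniverse hHD hI h₁ h₃).Fact_pull_hodge) :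
    ∀ (Γ₁ Γ : Level V) (hle : Γ.Γ ≤ Γ₁.Γ) (hK : Γ.K ≤ Γ₁.K)
        (ω₁ ω₂ : (picardCMUniverse hHD hI h₁ h₃).CohC ((picardCMUniverse hHD hI h₁ h₃).pms L ι₁ V Γ₁) 1),
      ω₁ ∈ (picardCMUniverse hHD hI h₁ h₃).H10 ((picardCMUniverse hHD hI h₁ h₃).pms L ι₁ V Γ₁) → ω₂ ∈ (picardCMUniverse hHD hI h₁ h₃).H10 ((picardCMUniverse hHD hI h₁ h₃).pms L ι₁ V Γ₁) →
      haveI := compactSpace_subQuot V hV Γ₁.K Γ.K hK Γ.isOpen_K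
      (pinT hHD hI h₁ h₃ h hA W S μ).emb Γ ((picardCMUniverse hHD hI h₁ h₃).pullC ((pinT hHD hI h₁ h₃ h hA W S μ).cover Γ₁ Γ hle) (1 + 1)
        ((picardCMUniverse hHD hI h₁ h₃).cup2C ((picardCMUniverse hHD hI h₁ h₃).pms L ι₁ V Γ₁) 1 ω₁ ω₂)) =
        (quotU V).pieceEmb (adelicUnitaryRat (L : Type) V.Hm) (regimeEquivT V hV) (regimeEquivT_mem_Γ_iff V hV)
          (cmSplitLevel (L : Type) 3 V.Hm Γ.K)
          ((cmSplitProj (L : Type) 3 V.Hm Γ₁.K).comp (Subgroup.inclusion (splitLevel_mono (cmAdelicProdEquiv (L : Type) 3 V.Hm).toMulEquiv hK)))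
          (cmPrincipalPoint (L : Type) 3 V.Hm)
          (isOpen_cmSplitLevel (L : Type) 3 V.Hm Γ.K Γ.isOpen_K)
          ((continuous_cmSplitProj (L : Type) 3 V.Hm Γ₁.K).comp (continuous_inclusion (splitLevel_mono (cmAdelicProdEquiv (L : Type) 3 V.Hm).toMulEquiv hK)))
          ((embPieceFun hHD hI h₁ h₃ V hV Γ₁ ((picardCMUniverse hHD hI h₁ h₃).cup2C ((picardCMUniverse hHD hI h₁ h₃).pms L ι₁ V Γ₁) 1 ω₁ ω₂)).comp
            (levelCoverCM (cmSplitLevel (L : Type) 3 V.Hm Γ₁.K) (adelicUnitaryRat (L : Type) V.Hm) (cmSplitProj (L : Type) 3 V.Hm Γ₁.K)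
              (cmPrincipalPoint (L : Type) 3 V.Hm) (cmSplitLevel (L : Type) 3 V.Hm Γ.K) (splitLevel_mono (cmAdelicProdEquiv (L : Type) 3 V.Hm).toMulEquiv hK))) :=
  by
  intro Γ₁ Γ hle hK ω₁ ω₂ hω₁ hω₂
  haveI := compactSpace_subQuot V hV Γ₁.K Γ.K hK Γ.isOpen_K
  exact embOf_pullC_cover_cup2C_eq_pieceLift hHD hI h₁ h₃ hA hcup hph hV Γ₁ Γ hle
    (splitLevel_mono (cmAdelicProdEquiv (L : Type) 3 V.Hm).toMulEquiv hK) ω₁ ω₂ hω₁ hω₂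

/-- **The (34) junctions of the context `(V, c)`** (regime `hV`): the admissible-representative record `Real34Loc` (kit #14 r3) extended by
(K34) `gen_mem` at `wset := Real34Loc.wset` (binder-2's `QautCore` shell — the one CONTENT field), D-1′'s frame junction `hι` and C3 for the
types `2, 3`.  A HYPOTHESIS record; nothing asserted. -/
structure Real34Junctions extends Real34Loc hHD hI h₁ h₃ h hA W S μ V c hV where
  /-- (K34) PerL Lemma 3.5 (34), FUNCTION form: `ϑ₃₄(χ, Φ) ∈ closure (span wset)` for the admissible-representative `wset` -/
  gen_mem : ∀ (χ : ((pinT hHD hI h₁ h₃ h hA W S μ).t34 V c).X) (Φ : (pinT hHD hI h₁ h₃ h hA W S μ).SK V c),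
    ((pinT hHD hI h₁ h₃ h hA W S μ).t34 V c).ϑ χ Φ ∈ (Submodule.span ℂ toReal34Loc.wset).topologicalClosure
  /-- (D-1′) the archimedean component of `S` is the section at `ι₁` in the uniform Sylvester frame -/
  hι : ∀ u : U21, (S V c).ιinf u =
    Adelic.regimeEquiv L V.Hm hV (archSectionU21CM (L : Type) ι₁ V.Hm V.sylvesterFrame (sylvesterFrame_J V) u)
  /-- C3 for type `2`: theta one-forms are `U_{Ψ₂}`-classes -/
  hU₂ : ∀ Γ : Level V, (pinT hHD hI h₁ h₃ h hA W S μ).Theta V c 2 Γ ⊆ (picardCMUniverse hHD hI h₁ h₃).Uiso Γ c.K (c.Ψ 2) c.σ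
  /-- C3 for type `3` -/
  hU₃ : ∀ Γ : Level V, (pinT hHD hI h₁ h₃ h hA W S μ).Theta V c 3 Γ ⊆ (picardCMUniverse hHD hI h₁ h₃).Uiso Γ c.K (c.Ψ 3) c.σ

/-- **The (34) function bridge at `(V, c)` in the regime** from the junction record, `Fact_pull_comp`/`Fact_pull_cup`, (J-cov′) and (E3). -/
def Real34Junctions.funBridge {hHD hI h₁ h₃ h hA W S μ} {V : HermSpace3 L ι₁} {c : SeesawCtx L} {hV : IsAnisotropic L V.Hm}
    (J : Real34Junctions hHD hI h₁ h₃ h hA W S μ V c hV)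
    (hpc : (picardCMUniverse hHD hI h₁ h₃).Fact_pull_comp) (hcup : (picardCMUniverse hHD hI h₁ h₃).Fact_pull_cup) (hph : (picardCMUniverse hHD hI h₁ h₃).Fact_pull_hodge)
    :
    (pinT hHD hI h₁ h₃ h hA W S μ).Real34FunBridge V c where
  wset := J.toReal34Loc.wset
  gen_mem := J.gen_mem
  meet := J.toReal34Loc.meet J.hι hpc hcup hph (hcov_holds hHD hI h₁ h₃ h hA W S μ V hV hcup hph) HodgeCM.Model.hlev_holds J.hU₂ J.hU₃

/-- **E's binder `real34` IN ITS QUANTIFIED FORM** from the (34) junction records at every good sextic context (regime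
`hV := isAnisotropic_of_goodCtx`), the universe facts `Fact_pull_comp` / `Fact_pull_cup`, glue-1's (J-cov′) and the level existence (E3)
(both for every `V` in its regime). -/
theorem real34_of_loc (hpc : (picardCMUniverse hHD hI h₁ h₃).Fact_pull_comp) (hcup : (picardCMUniverse hHD hI h₁ h₃).Fact_pull_cup) (hph : (picardCMUniverse hHD hI h₁ h₃).Fact_pull_hodge)
    (J : ∀ {L : CMField} {ι₁ : L →+* ℂ} (V : HermSpace3 L ι₁) (c : SeesawCtx L) (hV : IsAnisotropic L V.Hm),
      (pinT hHD hI h₁ h₃ h hA W S μ).GoodCtx ι₁ c → Module.finrank ℚ c.K = 6 → Real34Junctions hHD hI h₁ h₃ h hA W S μ V c hV)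
    {L : CMField} {ι₁ : L →+* ℂ} (V : HermSpace3 L ι₁) (c : SeesawCtx L)
    (hc : (pinT hHD hI h₁ h₃ h hA W S μ).GoodCtx ι₁ c) (hK : Module.finrank ℚ c.K = 6) :
    Nonempty ((pinT hHD hI h₁ h₃ h hA W S μ).Real34FunBridge V c) :=
  ⟨(J V c (isAnisotropic_of_goodCtx V hc hK) hc hK).funBridge hpc hcup hph⟩

end Model

end HodgeCM

end
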